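import Summits.FinalStateConjecture.FinalStateConjecture.Theorems.PhotonSphereChannelsCauchyWave

/-!
# Negative lemmas for crux `ChannelsResolveTameDevelopmentsR` (stmt-FinalStateConjecture-14075):
# silence calculus on the tortoise line — one-time silence is not rigid, the aperture is
# bookkeeping, two-sided hypotheses collapse on the time-symmetric class

Refuter lane (cdisprove, cycle 2).  The crux-ideate cards of this crux type their first lemmas
(`SilentModesAreStatic`, `EternalSilentWavesVanish`, `TwoSidedTrappingTime`) over the landed
vocabulary `Literature.Geometry.Lorentzian.ReggeWheeler.{exteriorEnergy, channelEnergy,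
totalEnergy, IsRWSolution}` with "silence" = vanishing channel energy of the time-shifted solution
`ψ(T + ·)` through the two-ended exterior cone of aperture `ρ` about `xc`, demanded for all
centres `T` and all apertures `ρ ≥ ρ₀`.  This file settles, sorry-free, the cheap structural
questions a skeleton will meet:

1. `energyDensity_eq_zero_of_vanish`, `channelEnergy_eq_zero_of_vanish`: a solution vanishing on a
   closed cone has zero channel energy through every strictly narrower cone.
2. `exists_oneTimeSilent_nonstatic`: for EVERY `M, r, xc, s ≤ ℓ, ρ₀ > 0` an explicit finite-energy
   global `C²` Regge–Wheeler solution (Cauchy data `(0, bump)` inside the ball, domain of influence,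
   `CauchyWave.stub_rwCauchy`) silent at base time `0` through every channel of aperture `ρ ≥ ρ₀`
   in both time directions, with `ψ(0,·) = 0` and `ψ ≢ 0`; hence the natural strengthenings
   "silent at ONE base time ⇒ static / ⇒ zero" are FALSE (`not_oneTimeSilence_static`,
   `not_oneTimeSilence_zero`): the `∀ T` of the cards is load-bearing.
3. `exteriorEnergy_antitone_aperture`, `channelEnergy_antitone_aperture`, `silentFrom_iff_silentAt`:
   `∀ ρ ≥ ρ₀` is the single aperture `ρ₀`.
4. `channelEnergy_aperture_top/bot`, `silentAllCentres_iff_aperture_zero`: given all centres, the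
   aperture is redundant (forward sheet of aperture `ρ` at centre `T` = bare light cone at centre
   `T − ρ`; backward: centre `T + ρ`).
5. `energyDensity_neg_eq_of_even`, `exteriorEnergy_reflect_eq_of_even`, `totalEnergy_neg_eq_of_even`,
   `twoSided_hypotheses_coincide_of_even`: on time-symmetric solutions the two concentration /
   silence hypotheses at `∓T` are one condition.

No definition is introduced; no Theses decl is asserted.
-/

noncomputable section

set_option linter.dupNamespace false

open Set Filter MeasureTheory Function Topology
open scoped ENNReal

namespace Summit.FinalStateConjecture.FinalStateConjecture.Theorems.ChannelsResolveTameDevelopmentsR.Negative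

open Literature.Geometry.Lorentzian Literature.Geometry.Lorentzian.ReggeWheeler

/-! ## 1–2. Cone vanishing; one-time silence is not rigid -/

/-- Vanishing on a closed cone kills the energy density on every strictly smaller open cone.
[folklore] -/
theorem energyDensity_eq_zero_of_vanish (V : ℝ → ℝ) {ψ : ℝ → ℝ → ℝ} {xc a b : ℝ} (hab : a < b)
    (hzero : ∀ τ y, a + |τ| ≤ |y - xc| → ψ τ y = 0) {t x : ℝ} (hx : b + |t| < |x - xc|) :
    energyDensity V ψ t x = 0 := by
  have ht : (fun τ ↦ ψ τ x) =ᶠ[𝓝 t] fun _ ↦ (0 : ℝ) := by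
    have hopen : IsOpen {τ : ℝ | a + |τ| < |x - xc|} :=
      isOpen_lt (continuous_const.add continuous_abs) continuous_const
    have hmem : t ∈ {τ : ℝ | a + |τ| < |x - xc|} := by
      show a + |t| < |x - xc|
      linarith
    filter_upwards [hopen.mem_nhds hmem] with τ hτ
    exact hzero τ x (le_of_lt hτ)
  have hxs : (fun y ↦ ψ t y) =ᶠ[𝓝 x] fun _ ↦ (0 : ℝ) := by
    have hopen : IsOpen {y : ℝ | a + |t| < |y - xc|} :=
      isOpen_lt continuous_const ((continuous_id.sub continuous_const).abs)
    have hmem : x ∈ {y : ℝ | a + |t| < |y - xc|} := by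
      show a + |t| < |x - xc|
      linarith
    filter_upwards [hopen.mem_nhds hmem] with y hy
    exact hzero t y (le_of_lt hy)
  have h1 : deriv (fun τ ↦ ψ τ x) t = 0 := by
    rw [ht.deriv_eq]
    simp
  have h2 : deriv (ψ t) x = 0 := by
    have : deriv (fun y ↦ ψ t y) x = 0 := by
      rw [hxs.deriv_eq]
      simp
    simpa using this
  have h3 : ψ t x = 0 := hzero t x (by linarith [abs_nonneg t])
  unfold energyDensity
  rw [h1, h2, h3]
  ring

/-- Under the same vanishing hypothesis every channel energy of aperture `ρ > a` is `0`. [folklore] -/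
theorem channelEnergy_eq_zero_of_vanish (V : ℝ → ℝ) {ψ : ℝ → ℝ → ℝ} {xc a ρ : ℝ} (haρ : a < ρ)
    (hzero : ∀ τ y, a + |τ| ≤ |y - xc| → ψ τ y = 0) (l : Filter ℝ) [l.NeBot] :
    channelEnergy V xc ρ ψ l = 0 := by
  have hext : ∀ t, exteriorEnergy V xc ρ ψ t = 0 := by
    intro t
    unfold exteriorEnergy
    have hS : MeasurableSet {x : ℝ | ρ + |t| < |x - xc|} :=
      (isOpen_lt continuous_const ((continuous_id.sub continuous_const).abs)).measurableSet
    have hcongr : ∀ x ∈ {x : ℝ | ρ + |t| < |x - xc|},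
        ENNReal.ofReal (energyDensity V ψ t x) = 0 := by
      intro x hx
      rw [energyDensity_eq_zero_of_vanish V haρ hzero hx]
      simp
    rw [setLIntegral_congr_fun hS hcongr]
    simp
  unfold channelEnergy
  rw [show exteriorEnergy V xc ρ ψ = fun _ ↦ 0 from funext hext, liminf_const]

/-- **One-time silence is not rigid.** For every `M > 0`, tortoise radius function, mode `s ≤ ℓ`
and `ρ₀ > 0` there is a finite-energy global `C²` Regge–Wheeler solution with `ψ(0,·) = 0`, silent
at base time `0` through every channel of aperture `ρ ≥ ρ₀` in both time directions, and not
identically zero.  Witness: Cauchy data `(0, g)`, `g` a smooth bump with `g(xc) = 1` supported in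
`|x − xc| < ρ₀/2` (`CauchyWave.stub_rwCauchy`); domain of influence. [folklore] -/
theorem exists_oneTimeSilent_nonstatic {M : ℝ} (hM : 0 < M) {r : ℝ → ℝ} {xc : ℝ}
    (hr : IsTortoiseRadius M r xc) {s ℓ : ℕ} (hsℓ : s ≤ ℓ) {ρ₀ : ℝ} (hρ₀ : 0 < ρ₀) :
    ∃ ψ : ℝ → ℝ → ℝ, IsRWSolution M s ℓ r ψ ∧
      totalEnergy (linePotential M s ℓ r) ψ 0 < ⊤ ∧
      (∀ ρ, ρ₀ ≤ ρ →
        channelEnergy (linePotential M s ℓ r) xc ρ ψ atTop = 0 ∧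
        channelEnergy (linePotential M s ℓ r) xc ρ ψ atBot = 0) ∧
      (∀ x, ψ 0 x = 0) ∧ ¬ (∀ t x, ψ t x = 0) := by
  have _ := hM
  let g : ContDiffBump xc := ⟨ρ₀ / 4, ρ₀ / 2, by positivity, by linarith⟩
  have hg2 : ContDiff ℝ 2 (g : ℝ → ℝ) := g.contDiff
  have hsupp : ∀ x, x ≤ xc - ρ₀ / 2 ∨ xc + ρ₀ / 2 ≤ x → (g : ℝ → ℝ) x = 0 := by
    intro x hx
    apply g.zero_of_le_dist
    show ρ₀ / 2 ≤ dist x xc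
    rw [Real.dist_eq]
    rcases hx with hx | hx
    · rw [abs_of_nonpos (by linarith)]
      linarith
    · rw [abs_of_nonneg (by linarith)]
      linarith
  obtain ⟨ψ, hsol, h0, h1, hvan⟩ :=
    CauchyWave.stub_rwCauchy hr s ℓ hsℓ (g : ℝ → ℝ) hg2 (xc - ρ₀ / 2) (xc + ρ₀ / 2) hsupp
  have hzero : ∀ τ y, ρ₀ / 2 + |τ| ≤ |y - xc| → ψ τ y = 0 := by
    intro τ y hy
    apply hvan τ y
    rcases le_or_gt 0 (y - xc) with hyc | hyc
    · rw [abs_of_nonneg hyc] at hy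
      right
      linarith
    · rw [abs_of_neg hyc] at hy
      left
      linarith
  refine ⟨ψ, hsol, ?_, fun ρ hρ ↦ ⟨?_, ?_⟩, h0, ?_⟩
  · have hψ0 : ψ 0 = fun _ ↦ (0 : ℝ) := funext h0
    have hdens : ∀ x, energyDensity (linePotential M s ℓ r) ψ 0 x = (g : ℝ → ℝ) x ^ 2 := by
      intro x
      unfold energyDensity
      rw [h1 x, hψ0]
      simp
    have hint : Integrable (fun x ↦ (g : ℝ → ℝ) x ^ 2) volume := by
      apply Continuous.integrable_of_hasCompactSupport
      · exact g.continuous.pow 2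
      · exact g.hasCompactSupport.comp_left (g := fun y : ℝ ↦ y ^ 2) (by simp)
    unfold totalEnergy
    simp_rw [hdens]
    exact hint.lintegral_lt_top
  · exact channelEnergy_eq_zero_of_vanish _ (by linarith) hzero atTop
  · exact channelEnergy_eq_zero_of_vanish _ (by linarith) hzero atBot
  · intro hall
    have hgc : (g : ℝ → ℝ) xc = 1 := g.one_of_mem_closedBall (by simp [g.rIn_pos.le])
    have hd : deriv (fun τ ↦ ψ τ xc) 0 = 0 := by
      have : (fun τ ↦ ψ τ xc) = fun _ ↦ (0 : ℝ) := funext fun τ ↦ hall τ xc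
      rw [this]
      simp
    rw [h1 xc, hgc] at hd
    exact one_ne_zero hd

/-- **The natural strengthening "silent at ONE base time ⇒ static" is false** (it drops the
`∀ T` of `SilentModesAreStatic` / `EternalSilentWavesVanish`; witness of
`exists_oneTimeSilent_nonstatic` at `M = 1`, `xc = 0`, `s = ℓ = 0`, `ρ₀ = 1`). [folklore] -/
theorem not_oneTimeSilence_static :
    ¬ ∀ (M : ℝ), 0 < M → ∀ (r : ℝ → ℝ) (xc : ℝ), IsTortoiseRadius M r xc →
      ∀ (s ℓ : ℕ), s ≤ 2 → s ≤ ℓ → ∀ ρ₀ : ℝ, 0 ≤ ρ₀ → ∀ ψ : ℝ → ℝ → ℝ,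
        IsRWSolution M s ℓ r ψ → totalEnergy (linePotential M s ℓ r) ψ 0 < ⊤ →
        (∀ ρ, ρ₀ ≤ ρ →
          channelEnergy (linePotential M s ℓ r) xc ρ ψ atTop = 0 ∧
          channelEnergy (linePotential M s ℓ r) xc ρ ψ atBot = 0) →
        ∀ t x, ψ t x = ψ 0 x := by
  intro h
  obtain ⟨r, hr⟩ := exists_isTortoiseRadius one_pos (0 : ℝ)
  obtain ⟨ψ, hsol, hE, hsil, h0, hne⟩ :=
    exists_oneTimeSilent_nonstatic one_pos hr (s := 0) (ℓ := 0) le_rfl one_pos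
  apply hne
  intro t x
  rw [h 1 one_pos r 0 hr 0 0 (by norm_num) le_rfl 1 zero_le_one ψ hsol hE hsil t x, h0 x]

/-- **A fortiori "silent at ONE base time ⇒ zero" is false.** [folklore] -/
theorem not_oneTimeSilence_zero :
    ¬ ∀ (M : ℝ), 0 < M → ∀ (r : ℝ → ℝ) (xc : ℝ), IsTortoiseRadius M r xc →
      ∀ (s ℓ : ℕ), s ≤ 2 → s ≤ ℓ → ∀ ρ₀ : ℝ, 0 ≤ ρ₀ → ∀ ψ : ℝ → ℝ → ℝ,
        IsRWSolution M s ℓ r ψ → totalEnergy (linePotential M s ℓ r) ψ 0 < ⊤ →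
        (∀ ρ, ρ₀ ≤ ρ →
          channelEnergy (linePotential M s ℓ r) xc ρ ψ atTop = 0 ∧
          channelEnergy (linePotential M s ℓ r) xc ρ ψ atBot = 0) →
        ∀ t x, ψ t x = 0 := by
  intro h
  obtain ⟨r, hr⟩ := exists_isTortoiseRadius one_pos (0 : ℝ)
  obtain ⟨ψ, hsol, hE, hsil, -, hne⟩ :=
    exists_oneTimeSilent_nonstatic one_pos hr (s := 0) (ℓ := 0) le_rfl one_pos
  exact hne (h 1 one_pos r 0 hr 0 0 (by norm_num) le_rfl 1 zero_le_one ψ hsol hE hsil)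

/-! ## 3. Aperture monotonicity -/

/-- The exterior energy is antitone in the aperture (the cone shrinks). [folklore] -/
theorem exteriorEnergy_antitone_aperture (V : ℝ → ℝ) (xc : ℝ) (φ : ℝ → ℝ → ℝ) (t : ℝ)
    {ρ₁ ρ₂ : ℝ} (h : ρ₁ ≤ ρ₂) : exteriorEnergy V xc ρ₂ φ t ≤ exteriorEnergy V xc ρ₁ φ t := by
  unfold exteriorEnergy
  refine lintegral_mono_set fun x hx ↦ ?_
  simp only [mem_setOf_eq] at hx ⊢
  linarith

/-- The channel energy is antitone in the aperture. [folklore] -/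
theorem channelEnergy_antitone_aperture (V : ℝ → ℝ) (xc : ℝ) (φ : ℝ → ℝ → ℝ) (l : Filter ℝ)
    {ρ₁ ρ₂ : ℝ} (h : ρ₁ ≤ ρ₂) : channelEnergy V xc ρ₂ φ l ≤ channelEnergy V xc ρ₁ φ l := by
  unfold channelEnergy
  exact liminf_le_liminf (Eventually.of_forall fun t ↦ exteriorEnergy_antitone_aperture V xc φ t h)

/-- **Silence from `ρ₀` on is silence at `ρ₀`.** The quantifier `∀ ρ ≥ ρ₀` in L1/L4 (and in
the silence clauses of every card) can be replaced by the single aperture `ρ₀`. [folklore] -/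
theorem silentFrom_iff_silentAt (V : ℝ → ℝ) (xc ρ₀ : ℝ) (φ : ℝ → ℝ → ℝ) (l : Filter ℝ) :
    (∀ ρ, ρ₀ ≤ ρ → channelEnergy V xc ρ φ l = 0) ↔ channelEnergy V xc ρ₀ φ l = 0 := by
  refine ⟨fun h ↦ h ρ₀ le_rfl, fun h ρ hρ ↦ ?_⟩
  exact le_antisymm ((channelEnergy_antitone_aperture V xc φ l hρ).trans (le_of_eq h)) bot_le

/-! ## 4. The aperture is redundant given all centres -/

/-- Energy density of the time-shifted solution at time `t`. [folklore] -/
theorem energyDensity_shift_at (V : ℝ → ℝ) (ψ : ℝ → ℝ → ℝ) (a t x : ℝ) :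
    energyDensity V (fun s y ↦ ψ (a + s) y) t x = energyDensity V ψ (a + t) x := by
  unfold energyDensity
  have key : ∀ f : ℝ → ℝ, deriv (fun τ ↦ f (a + τ)) t = deriv f (a + t) := fun f ↦ by
    rw [deriv_comp_const_add]
  have hd : deriv (fun τ ↦ ψ (a + τ) x) t = deriv (fun τ ↦ ψ τ x) (a + t) := key fun σ ↦ ψ σ x
  simp only [hd]

/-- **Forward exterior energies: aperture `ρ` at centre `T` = aperture `0` at centre `T − ρ`**
(for `t ≥ 0`, after the time shift `t ↦ t + ρ`; the two cones have the same forward sheets).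
[folklore] -/
theorem exteriorEnergy_aperture_top (V : ℝ → ℝ) (ψ : ℝ → ℝ → ℝ) (xc : ℝ) {ρ : ℝ} (hρ : 0 ≤ ρ)
    (T : ℝ) {t : ℝ} (ht : 0 ≤ t) :
    exteriorEnergy V xc ρ (fun s y ↦ ψ (T + s) y) t =
      exteriorEnergy V xc 0 (fun s y ↦ ψ (T - ρ + s) y) (t + ρ) := by
  unfold exteriorEnergy
  have hset : {x : ℝ | ρ + |t| < |x - xc|} = {x : ℝ | 0 + |t + ρ| < |x - xc|} := by
    ext x
    simp only [mem_setOf_eq]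
    rw [abs_of_nonneg ht, abs_of_nonneg (show 0 ≤ t + ρ by linarith), zero_add, add_comm]
  rw [hset]
  refine lintegral_congr fun x ↦ ?_
  rw [energyDensity_shift_at, energyDensity_shift_at, show T - ρ + (t + ρ) = T + t by ring]

/-- **Backward exterior energies: aperture `ρ` at centre `T` = aperture `0` at centre `T + ρ`**
(for `t ≤ 0`, after the time shift `t ↦ t − ρ`). [folklore] -/
theorem exteriorEnergy_aperture_bot (V : ℝ → ℝ) (ψ : ℝ → ℝ → ℝ) (xc : ℝ) {ρ : ℝ} (hρ : 0 ≤ ρ)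
    (T : ℝ) {t : ℝ} (ht : t ≤ 0) :
    exteriorEnergy V xc ρ (fun s y ↦ ψ (T + s) y) t =
      exteriorEnergy V xc 0 (fun s y ↦ ψ (T + ρ + s) y) (t - ρ) := by
  unfold exteriorEnergy
  have hset : {x : ℝ | ρ + |t| < |x - xc|} = {x : ℝ | 0 + |t - ρ| < |x - xc|} := by
    ext x
    simp only [mem_setOf_eq]
    rw [abs_of_nonpos ht, abs_of_nonpos (show t - ρ ≤ 0 by linarith), zero_add, neg_sub]
    constructor <;> intro h <;> linarith
  rw [hset]
  refine lintegral_congr fun x ↦ ?_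
  rw [energyDensity_shift_at, energyDensity_shift_at, show T + ρ + (t - ρ) = T + t by ring]

/-- Forward channel energies: aperture `ρ ≥ 0` at centre `T` = aperture `0` at centre `T − ρ`.
[folklore] -/
theorem channelEnergy_aperture_top (V : ℝ → ℝ) (ψ : ℝ → ℝ → ℝ) (xc : ℝ) {ρ : ℝ} (hρ : 0 ≤ ρ)
    (T : ℝ) :
    channelEnergy V xc ρ (fun s y ↦ ψ (T + s) y) atTop =
      channelEnergy V xc 0 (fun s y ↦ ψ (T - ρ + s) y) atTop := by
  unfold channelEnergy
  have h1 : liminf (exteriorEnergy V xc ρ (fun s y ↦ ψ (T + s) y)) atTop =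
      liminf ((exteriorEnergy V xc 0 (fun s y ↦ ψ (T - ρ + s) y)) ∘ fun t ↦ t + ρ) atTop := by
    refine liminf_congr ?_
    filter_upwards [eventually_ge_atTop (0 : ℝ)] with t ht
    exact exteriorEnergy_aperture_top V ψ xc hρ T ht
  rw [h1, liminf_comp, map_add_atTop_eq]

/-- Backward channel energies: aperture `ρ ≥ 0` at centre `T` = aperture `0` at centre `T + ρ`.
[folklore] -/
theorem channelEnergy_aperture_bot (V : ℝ → ℝ) (ψ : ℝ → ℝ → ℝ) (xc : ℝ) {ρ : ℝ} (hρ : 0 ≤ ρ)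
    (T : ℝ) :
    channelEnergy V xc ρ (fun s y ↦ ψ (T + s) y) atBot =
      channelEnergy V xc 0 (fun s y ↦ ψ (T + ρ + s) y) atBot := by
  unfold channelEnergy
  have h1 : liminf (exteriorEnergy V xc ρ (fun s y ↦ ψ (T + s) y)) atBot =
      liminf ((exteriorEnergy V xc 0 (fun s y ↦ ψ (T + ρ + s) y)) ∘ fun t ↦ t - ρ) atBot := by
    refine liminf_congr ?_
    filter_upwards [eventually_le_atBot (0 : ℝ)] with t ht
    exact exteriorEnergy_aperture_bot V ψ xc hρ T ht
  have h₁ : Tendsto (fun t : ℝ ↦ t - ρ) atBot atBot := by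
    simpa [sub_eq_add_neg] using tendsto_atBot_add_const_right atBot (-ρ) tendsto_id
  have h₂ : Tendsto (fun t : ℝ ↦ t + ρ) atBot atBot := tendsto_atBot_add_const_right atBot ρ tendsto_id
  have hmap : map (fun t : ℝ ↦ t - ρ) atBot = atBot := by
    refine le_antisymm h₁ ?_
    calc (atBot : Filter ℝ) = map (fun t : ℝ ↦ t - ρ) (map (fun t : ℝ ↦ t + ρ) atBot) := by
          rw [map_map]
          simp [Function.comp_def]
      _ ≤ map (fun t : ℝ ↦ t - ρ) atBot := map_mono h₂
  rw [h1, liminf_comp, hmap]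

/-- **Silence at all centres does not see the aperture**: for `ρ ≥ 0`, silence through the
channel of aperture `ρ` at every centre `T` (both directions) is equivalent to silence through the
bare light cones (`ρ = 0`) at every centre.  Together with §3, the silence hypothesis block of the
cards reduces to `∀ T, channelEnergy V xc 0 (ψ(T + ·)) atTop = 0 ∧ … atBot = 0`. [folklore] -/
theorem silentAllCentres_iff_aperture_zero (V : ℝ → ℝ) (xc : ℝ) {ρ : ℝ} (hρ : 0 ≤ ρ)
    (ψ : ℝ → ℝ → ℝ) :
    (∀ T, channelEnergy V xc ρ (fun s y ↦ ψ (T + s) y) atTop = 0 ∧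
        channelEnergy V xc ρ (fun s y ↦ ψ (T + s) y) atBot = 0) ↔
      (∀ T, channelEnergy V xc 0 (fun s y ↦ ψ (T + s) y) atTop = 0 ∧
        channelEnergy V xc 0 (fun s y ↦ ψ (T + s) y) atBot = 0) := by
  constructor
  · intro h T
    refine ⟨?_, ?_⟩
    · have h' := (h (T + ρ)).1
      rwa [channelEnergy_aperture_top V ψ xc hρ, show T + ρ - ρ = T by ring] at h'
    · have h' := (h (T - ρ)).2
      rwa [channelEnergy_aperture_bot V ψ xc hρ, show T - ρ + ρ = T by ring] at h'
  · intro h T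
    exact ⟨by rw [channelEnergy_aperture_top V ψ xc hρ]; exact (h _).1,
      by rw [channelEnergy_aperture_bot V ψ xc hρ]; exact (h _).2⟩

/-! ## 5. Two-sided hypotheses collapse on the time-symmetric class -/

/-- The energy density of the time-shifted solution `t ↦ ψ(a + t)` at time `0` is the energy
density of `ψ` at time `a`. [folklore] -/
theorem energyDensity_shift (V : ℝ → ℝ) (ψ : ℝ → ℝ → ℝ) (a x : ℝ) :
    energyDensity V (fun t y ↦ ψ (a + t) y) 0 x = energyDensity V ψ a x := by
  unfold energyDensity
  have key : ∀ f : ℝ → ℝ, deriv (fun τ ↦ f (a + τ)) 0 = deriv f a := fun f ↦ by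
    rw [deriv_comp_const_add, add_zero]
  have hd : deriv (fun τ ↦ ψ (a + τ) x) 0 = deriv (fun τ ↦ ψ τ x) a := key fun σ ↦ ψ σ x
  simp only [hd, add_zero]

/-- **Time reflection.** For a time-symmetric `ψ` (`ψ(−t, x) = ψ(t, x)`) the energy density is
even in time. [folklore] -/
theorem energyDensity_neg_eq_of_even (V : ℝ → ℝ) {ψ : ℝ → ℝ → ℝ} (heven : ∀ t x, ψ (-t) x = ψ t x)
    (T x : ℝ) : energyDensity V ψ (-T) x = energyDensity V ψ T x := by
  unfold energyDensity
  have key : ∀ f : ℝ → ℝ, deriv (fun τ ↦ f (-τ)) (-T) = -deriv f T := fun f ↦ by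
    rw [deriv_comp_neg, neg_neg]
  have hfun : (fun τ ↦ ψ τ x) = fun τ ↦ ψ (-τ) x := funext fun τ ↦ (heven τ x).symm
  have hd : deriv (fun τ ↦ ψ τ x) (-T) = -deriv (fun τ ↦ ψ τ x) T :=
    (congrArg (fun f : ℝ → ℝ ↦ deriv f (-T)) hfun).trans (key fun σ ↦ ψ σ x)
  have h0 : ψ (-T) = ψ T := funext fun y ↦ heven T y
  rw [hd, h0, neg_sq]

/-- Hence, on the time-symmetric class, the FIXED-ball exterior energies at `−T` and `+T` (the two
concentration hypotheses of `TwoSidedTrappingTime`, and the two halves of every "doubly silent"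
hypothesis) coincide.
[folklore] -/
theorem exteriorEnergy_reflect_eq_of_even (V : ℝ → ℝ) {ψ : ℝ → ℝ → ℝ}
    (heven : ∀ t x, ψ (-t) x = ψ t x) (xc ρ T : ℝ) :
    exteriorEnergy V xc ρ (fun t y ↦ ψ (-T + t) y) 0 =
      exteriorEnergy V xc ρ (fun t y ↦ ψ (T + t) y) 0 := by
  unfold exteriorEnergy
  refine lintegral_congr fun x ↦ ?_
  rw [energyDensity_shift, energyDensity_shift, energyDensity_neg_eq_of_even V heven]

/-- … and so do the total energies at `∓T`. [folklore] -/
theorem totalEnergy_neg_eq_of_even (V : ℝ → ℝ) {ψ : ℝ → ℝ → ℝ}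
    (heven : ∀ t x, ψ (-t) x = ψ t x) (T : ℝ) :
    totalEnergy V ψ (-T) = totalEnergy V ψ T := by
  unfold totalEnergy
  refine lintegral_congr fun x ↦ ?_
  rw [energyDensity_neg_eq_of_even V heven]

/-- **L2 restricted to time-symmetric solutions is a ONE-time statement**: for even `ψ` the second
concentration hypothesis of `TwoSidedTrappingTime` is literally the first.  (Even solutions with
data `(f, 0)` exist for every compactly supported `C²` `f`: `Blindness.exists_even_solution`.)
So any proof of L2 must already bound ONE-sided concentration times of time-symmetric data by
`C log ℓ` — consistent with the incoming/outgoing budget (`a + b ≤ E_F`) but a useful test of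
skeleton stubs that try to use the two times separately. [folklore] -/
theorem twoSided_hypotheses_coincide_of_even (V : ℝ → ℝ) {ψ : ℝ → ℝ → ℝ}
    (heven : ∀ t x, ψ (-t) x = ψ t x) (xc ρ T : ℝ) (δ : ℝ≥0∞) :
    (exteriorEnergy V xc ρ (fun t y ↦ ψ (-T + t) y) 0 ≤ δ * totalEnergy V ψ (-T)) ↔
      (exteriorEnergy V xc ρ (fun t y ↦ ψ (T + t) y) 0 ≤ δ * totalEnergy V ψ T) := by
  rw [exteriorEnergy_reflect_eq_of_even V heven, totalEnergy_neg_eq_of_even V heven]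

end Summit.FinalStateConjecture.FinalStateConjecture.Theorems.ChannelsResolveTameDevelopmentsR.Negative

end
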